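import Literature.IUT.LogThetaLattice.VerticallyCoricLGP
import Literature.IUT.LogThetaLattice.TensorPackets
import Literature.IUT.LogThetaLattice.HolomorphicLogShellsProofs
import HarnessLib

/-!
# [IUTchIII] Proposition 3.5 (ii) (a) "(Nonarchimedean Primes)" at the level of the TENSOR PACKETS of
# Proposition 3.2 (ii), over the GENUINE `p`-adic logarithms — proof-only companion of `VerticallyCoricLGP.lean`
# and `TensorPackets.lean` (abc-iut cell, layer L6, slice [IUTchIII] §3)

S. Mochizuki, *Inter-universal Teichmüller theory III*, kurims manuscript (May 2020), §3, Proposition 3.5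
(ii) (a), pp. 104–105, read on the page [claim: Mochizuki2012, status: disputed]: "For `v_ℚ ∈ 𝕍^non_ℚ`, the
topological module `𝓘(^{S^±_{j+1}}𝓕(^{n,∘}𝔇_≻)_{v_ℚ})` — i.e., that arises from applying the constructions of
Proposition 3.4, (ii) [where we allow "`j`" to be `0`], in the vertically coric context of (i) above [cf.
also the notational conventions of Proposition 3.2, (ii)] — contains the images of the submodules of
Galois invariants … of the groups of units `(Ψ_cns(^{n,m}𝔉_≻)_{|t|})^×_v`, for `𝕍 ∋ v | v_ℚ` and
`|t| ∈ {0, …, j}`, via both (1) the tensor product, over such `|t|`, of the [relevant] Kummer isomorphisms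
of (i), and (2) the tensor product, over such `|t|`, of the pre-composite of these Kummer isomorphisms with
the `m'`-th iterates [cf. Remark 1.1.1] of the log-links, for `m' ≥ 1`, of the `n`-th column".

abc-iut-L6-t4's statement files type the clause as the predicate `Prop35ii_a I U κ lam`
(`VerticallyCoricLGP.lean`, p403950) and the packet-level log-shells of Proposition 3.2 (ii) p. 98 as
`shellPacketN 𝕜 D I` = the additive subgroup of the `n`-tensor packet `log(^A𝒟^⊢_{v_ℚ}) = ⊗_{α∈A} ⊕_{v|v_ℚ}
log(^α𝒟^⊢_v)` (`MPacketN`) generated by the pure tensors of elements of `𝓘(^α𝒟^⊢_{v_ℚ}) = ⊕_v 𝓘_{^α𝒟^⊢_v}`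
(`shellPacket1`), resp. `shellPacketAt 𝕜 D I α v ⊆ log(^{A,α}𝒟^⊢_v)` (`TensorPackets.lean`, p403825). This
file DISCHARGES the clause AT THE PACKET LEVEL (all tensor factors `|t| ∈ A = S^±_{j+1}`, all `v | v_ℚ`) for
the tree's models of the log-link, complementing the one-factor file `VerticallyCoricLGPNonarch.lean`:

* data (vertical coricity, [IUTchIII] Prop. 3.5 (i): ONE étale-like packet for the whole column): base
  field `𝕜 := ℚ_p`; summand fields `K α v` (mixed-characteristic ultrametric, `NormedAlgebra ℚ_[p]`) with a
  model `Lg α v : PadicLogOnUnits (K α v)` of the `p`-adic logarithm on units (abc-iut-L4-t3, [AbsTopIII]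
  Def. 5.4 (iii)); local log-shells `𝓘_{α,v} := ℐ_{K α v}` (`logShell`, entered into the packet shells
  through the additive subgroups they generate); unit groups `U m := ∏_{α,v} 𝒪^×_{K α v}` for every `m`;
  Kummer maps `κ m (u) := ⊗_α (u_{α,v})_v` (the pure tensor of the units read in the coric copy,
  [IUTchIII] Rmk. 1.2.2 (i) "`𝒪^× ⊆ 𝒪 ⊆ ℐ`"); `lam m m' (u) := ⊗_α (log^{[m']}(u_{α,v}))_v` when EVERY
  component lies in the domain `D_{m'}` of the `m'`-th iterate (abc-iut-L6-t3's `iterDomain`, [IUTchIII] Rmk.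
  1.1.1 (i)), undefined (`none`) otherwise;
* `prop35ii_a_shellPacketN` — `Prop35ii_a` HOLDS for `I := shellPacketN ℚ_[p] K (closures of the ℐ_{α,v})`
  given `ℐ* ⊆ ℐ` in every factor (clause (1): pure tensors of units are pure tensors of shell elements,
  abc-iut-L4-t3's `closedBall_subset_logShell`; clause (2): abc-iut-L6-t3's "upper semi-commutativity"
  `iterate_image_subset_logShell`, factor by factor); `prop35ii_a_shellPacketN_ofUnitLog` —
  UNCONDITIONALLY when every `Lg α v` is the standard model `PadicLogOnUnits.ofUnitLog p (K α v)` (the real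
  `log_p`, abc-iut-L3-t11/S1; `[ProperSpace]`), by abc-iut-L6-d2's `preLogShell_subset_logShell_ofUnitLog`;
* `prop35ii_a_shellPacketAt`, `prop35ii_a_shellPacketAt_ofUnitLog` — the same for the `(A, α)`-packet
  `𝓘(^{A,α}𝒟^⊢_v) ⊆ log(^{A,α}𝒟^⊢_v)` (`shellPacketAt`; the `j`-labelled sub-packets `𝓘(^{S^±_{j+1},j}…)` of
  Thm. 3.11 (i) are of this shape), with Kummer maps `u ↦ u_{α,v} ⊗ (⊗_{β≠α} (u_{β,w})_w)`.

Dictionary for the Cor. 3.12 crew: abc-iut-c312-1's `Thm311.LogShells.Packet = MPacketN` (Thm311Dictionary,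
`rfl`) and abc-iut-c312-5's `LogShells.shellPk j v_ℚ = AddSubgroup.closure {tprod x | x i v ∈ closure (shell v)}`
(Thm311Real2) have the shape of `shellPacketN` here; `Column.ind3_non_of_prop35ii_a` consumes `Prop35ii_a` at
exactly this packet level. No new definitions; classical `p`-adic analysis and multilinear bookkeeping only;
nothing here bears on the disputed [IUTchIII] Cor. 3.12 or takes a side; typed ≠ discharged elsewhere.
-/

noncomputable section

namespace Literature.IUT.LogThetaLattice

open Set Metric Literature.AnabelianGeometry.AbsoluteAnabelian
open scoped TensorProduct
open PiTensorProduct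

universe v v' w

section Packets

variable (p : ℕ) [Fact p.Prime]
variable {A : Type v} [Fintype A] {Vfib : Type v'} [Fintype Vfib]
variable (K : A → Vfib → Type w) [∀ α v, NontriviallyNormedField (K α v)]
  [∀ α v, NormedAlgebra ℚ_[p] (K α v)] [∀ α v, IsUltrametricDist (K α v)]
variable (Lg : ∀ α v, PadicLogOnUnits (K α v))

omit [Fintype A] [Fintype Vfib] [∀ α v, NormedAlgebra ℚ_[p] (K α v)] in
/-- A unit `u ∈ 𝒪^×_{K α v}` read in the coric copy lies in (the subgroup generated by) the local log-shell:
`𝒪^× ⊆ 𝒪 ⊆ ℐ` ([IUTchIII] Rmk. 1.2.2 (i); abc-iut-L4-t3's `closedBall_subset_logShell`).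
[claim: Mochizuki2012, status: disputed] -/
private theorem unit_mem_closure_logShell (α : A) (v : Vfib) (u : ↥(sphere (0 : K α v) 1)) :
    (u : K α v) ∈ AddSubgroup.closure (logShell (Lg α v)) :=
  AddSubgroup.subset_closure (closedBall_subset_logShell (Lg α v) (sphere_subset_closedBall u.2))

omit [Fintype A] [Fintype Vfib] [∀ α v, NormedAlgebra ℚ_[p] (K α v)]
  [∀ α v, IsUltrametricDist (K α v)] in
/-- The image of a unit under the `(k+1)`-st iterate of the log-link, where defined, lies in (the subgroup
generated by) the local log-shell — abc-iut-L6-t3's "upper semi-commutativity" ([IUTchIII] Rmk. 1.2.2 (iii))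
given `ℐ* ⊆ ℐ`. [claim: Mochizuki2012, status: disputed] -/
private theorem iterate_mem_closure_logShell (hc : ∀ α v, preLogShell (Lg α v) ⊆ logShell (Lg α v)) (α : A)
    (v : Vfib) (k : ℕ) {x : K α v} (hx : x ∈ iterDomain (Lg α v) (k + 1)) :
    (Lg α v).log^[k + 1] x ∈ AddSubgroup.closure (logShell (Lg α v)) :=
  AddSubgroup.subset_closure (iterate_image_subset_logShell (Lg α v) (hc α v) k ⟨x, hx, rfl⟩)

open Classical in
/-- **IUTchIII:Prop3.5(ii)(a)** (kurims pp. 104–105) AT THE PACKET LEVEL over models of the `p`-adic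
logarithms with `ℐ* ⊆ ℐ` in every factor: the packet log-shell `𝓘(^A𝒟^⊢_{v_ℚ}) ⊆ log(^A𝒟^⊢_{v_ℚ})` of
Proposition 3.2 (ii) (abc-iut-L6-t4's `shellPacketN`, generated by the pure tensors of shell elements)
contains (1) the images `⊗_α (u_{α,v})_v` of the unit groups `∏_{α,v} 𝒪^×_{K α v}` (tensor product over the
factors `|t| ∈ A` of the units read in the coric copy via the Kummer isomorphisms) and (2) the images
`⊗_α (log^{[m']} u_{α,v})_v` of the tensor products of the pre-composites with the `m'`-th iterates (`m' ≥ 1`)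
of the log-links on the portions of the units where they are defined — i.e. `Prop35ii_a` HOLDS for this
data. [claim: Mochizuki2012, status: disputed] -/
theorem prop35ii_a_shellPacketN (hc : ∀ α v, preLogShell (Lg α v) ⊆ logShell (Lg α v)) :
    Prop35ii_a (X := MPacketN ℚ_[p] K)
      (shellPacketN ℚ_[p] K (fun α v => AddSubgroup.closure (logShell (Lg α v))) : Set (MPacketN ℚ_[p] K))
      (fun _ : ℤ => ∀ α v, ↥(sphere (0 : K α v) 1))
      (fun _ u => tprod ℚ_[p] fun α => fun v => (u α v : K α v))
      (fun _ (m' : ℕ) _ u =>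
        if ∀ α v, (u α v : K α v) ∈ iterDomain (Lg α v) m' then
          some (tprod ℚ_[p] fun α => fun v => (Lg α v).log^[m'] (u α v : K α v))
        else none) := by
  refine ⟨fun m u => ?_, fun m m' hm u x hx => ?_⟩
  · refine AddSubgroup.subset_closure ⟨fun α v => (u α v : K α v), fun α => ?_, rfl⟩
    exact (AddSubgroup.mem_pi _).mpr fun v _ => unit_mem_closure_logShell K Lg α v (u α v)
  · dsimp only at hx
    split_ifs at hx with hu
    obtain ⟨k, rfl⟩ : ∃ k, m' = k + 1 := ⟨m' - 1, by omega⟩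
    rw [Option.some.injEq] at hx
    subst hx
    refine AddSubgroup.subset_closure ⟨fun α v => (Lg α v).log^[k + 1] (u α v : K α v), fun α => ?_, rfl⟩
    exact (AddSubgroup.mem_pi _).mpr fun v _ => iterate_mem_closure_logShell K Lg hc α v k (hu α v)

open Classical in
/-- **IUTchIII:Prop3.5(ii)(a)** (kurims pp. 104–105) for the `(A, α)`-PACKET `𝓘(^{A,α}𝒟^⊢_v) ⊆ log(^{A,α}𝒟^⊢_v)`
of Proposition 3.2 (ii) (abc-iut-L6-t4's `shellPacketAt`; the shape of the `j`-labelled sub-packets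
`𝓘(^{S^±_{j+1},j}𝓕(^{n,∘}𝔇_≻)_v)` of Thm. 3.11 (i)), over models with `ℐ* ⊆ ℐ` in every factor: it contains
the images `u_{α,v} ⊗ (⊗_{β≠α} (u_{β,w})_w)` of the unit groups and of their `m'`-th log-iterate
pre-composites where defined — `Prop35ii_a` HOLDS. [claim: Mochizuki2012, status: disputed] -/
theorem prop35ii_a_shellPacketAt (hc : ∀ α v, preLogShell (Lg α v) ⊆ logShell (Lg α v)) (α : A)
    (v : Vfib) :
    Prop35ii_a (X := MPacketAt ℚ_[p] K α v)
      (shellPacketAt ℚ_[p] K (fun α v => AddSubgroup.closure (logShell (Lg α v))) α v :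
        Set (MPacketAt ℚ_[p] K α v))
      (fun _ : ℤ => ∀ β w, ↥(sphere (0 : K β w) 1))
      (fun _ u => (u α v : K α v) ⊗ₜ[ℚ_[p]]
        tprod ℚ_[p] fun β : {β : A // β ≠ α} => fun w => (u β.1 w : K β.1 w))
      (fun _ (m' : ℕ) _ u =>
        if ∀ β w, (u β w : K β w) ∈ iterDomain (Lg β w) m' then
          some ((Lg α v).log^[m'] (u α v : K α v) ⊗ₜ[ℚ_[p]]
            tprod ℚ_[p] fun β : {β : A // β ≠ α} => fun w => (Lg β.1 w).log^[m'] (u β.1 w : K β.1 w))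
        else none) := by
  refine ⟨fun m u => ?_, fun m m' hm u x hx => ?_⟩
  · refine AddSubgroup.subset_closure
      ⟨(u α v : K α v), fun β => fun w => (u β.1 w : K β.1 w), unit_mem_closure_logShell K Lg α v (u α v),
        fun β => ?_, rfl⟩
    exact (AddSubgroup.mem_pi _).mpr fun w _ => unit_mem_closure_logShell K Lg β.1 w (u β.1 w)
  · dsimp only at hx
    split_ifs at hx with hu
    obtain ⟨k, rfl⟩ : ∃ k, m' = k + 1 := ⟨m' - 1, by omega⟩
    rw [Option.some.injEq] at hx
    subst hx
    refine AddSubgroup.subset_closure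
      ⟨(Lg α v).log^[k + 1] (u α v : K α v), fun β => fun w => (Lg β.1 w).log^[k + 1] (u β.1 w : K β.1 w),
        iterate_mem_closure_logShell K Lg hc α v k (hu α v), fun β => ?_, rfl⟩
    exact (AddSubgroup.mem_pi _).mpr fun w _ => iterate_mem_closure_logShell K Lg hc β.1 w k (hu β.1 w)

end Packets

section Standard

variable (p : ℕ) [Fact p.Prime]
variable {A : Type v} [Fintype A] {Vfib : Type v'} [Fintype Vfib]
variable (K : A → Vfib → Type w) [∀ α v, NontriviallyNormedField (K α v)]
  [∀ α v, NormedAlgebra ℚ_[p] (K α v)] [∀ α v, IsUltrametricDist (K α v)] [∀ α v, ProperSpace (K α v)]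

open Classical in
/-- **IUTchIII:Prop3.5(ii)(a)** (kurims pp. 104–105) AT THE PACKET LEVEL, UNCONDITIONALLY at the genuine
`p`-adic logarithms `log_p : 𝒪^×_{K α v} → K α v` of mixed-characteristic local fields (every factor the
standard model `PadicLogOnUnits.ofUnitLog p (K α v)`): `Prop35ii_a` HOLDS for the packet log-shell
`𝓘(^A𝒟^⊢_{v_ℚ})` (`shellPacketN`), the unit groups `∏ 𝒪^×` with pure-tensor Kummer maps and the partial
iterates of `log_p` — the hypothesis `ℐ* ⊆ ℐ` being abc-iut-L6-d2's `preLogShell_subset_logShell_ofUnitLog`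
in each factor. [claim: Mochizuki2012, status: disputed] -/
theorem prop35ii_a_shellPacketN_ofUnitLog :
    Prop35ii_a (X := MPacketN ℚ_[p] K)
      (shellPacketN ℚ_[p] K (fun α v =>
        AddSubgroup.closure (logShell (PadicLogOnUnits.ofUnitLog p (K α v)))) : Set (MPacketN ℚ_[p] K))
      (fun _ : ℤ => ∀ α v, ↥(sphere (0 : K α v) 1))
      (fun _ u => tprod ℚ_[p] fun α => fun v => (u α v : K α v))
      (fun _ (m' : ℕ) _ u =>
        if ∀ α v, (u α v : K α v) ∈ iterDomain (PadicLogOnUnits.ofUnitLog p (K α v)) m' then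
          some (tprod ℚ_[p] fun α => fun v =>
            (PadicLogOnUnits.ofUnitLog p (K α v)).log^[m'] (u α v : K α v))
        else none) :=
  prop35ii_a_shellPacketN p K (fun α v => PadicLogOnUnits.ofUnitLog p (K α v))
    fun α v => preLogShell_subset_logShell_ofUnitLog p (K α v)

open Classical in
/-- **IUTchIII:Prop3.5(ii)(a)** (kurims pp. 104–105) for the `(A, α)`-PACKET, UNCONDITIONALLY at the genuine
`p`-adic logarithms (every factor the standard model): `Prop35ii_a` HOLDS for `𝓘(^{A,α}𝒟^⊢_v)`
(`shellPacketAt`). [claim: Mochizuki2012, status: disputed] -/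
theorem prop35ii_a_shellPacketAt_ofUnitLog (α : A) (v : Vfib) :
    Prop35ii_a (X := MPacketAt ℚ_[p] K α v)
      (shellPacketAt ℚ_[p] K (fun α v =>
        AddSubgroup.closure (logShell (PadicLogOnUnits.ofUnitLog p (K α v)))) α v :
          Set (MPacketAt ℚ_[p] K α v))
      (fun _ : ℤ => ∀ β w, ↥(sphere (0 : K β w) 1))
      (fun _ u => (u α v : K α v) ⊗ₜ[ℚ_[p]]
        tprod ℚ_[p] fun β : {β : A // β ≠ α} => fun w => (u β.1 w : K β.1 w))
      (fun _ (m' : ℕ) _ u =>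
        if ∀ β w, (u β w : K β w) ∈ iterDomain (PadicLogOnUnits.ofUnitLog p (K β w)) m' then
          some ((PadicLogOnUnits.ofUnitLog p (K α v)).log^[m'] (u α v : K α v) ⊗ₜ[ℚ_[p]]
            tprod ℚ_[p] fun β : {β : A // β ≠ α} => fun w =>
              (PadicLogOnUnits.ofUnitLog p (K β.1 w)).log^[m'] (u β.1 w : K β.1 w))
        else none) :=
  prop35ii_a_shellPacketAt p K (fun α v => PadicLogOnUnits.ofUnitLog p (K α v))
    (fun α v => preLogShell_subset_logShell_ofUnitLog p (K α v)) α v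

end Standard

end Literature.IUT.LogThetaLattice
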